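import Summits.CriticalPhenomena.Ising3DConformalLimit.Theses.LogPolarProxy
import Summits.CriticalPhenomena.Ising3DConformalLimit.Theorems.LogPolarProxyProxyUniversalitySymmetries
import Summits.CriticalPhenomena.Ising3DConformalLimit.Theorems.LogPolarProxyProxyUniversalityLatticeForm
import Summits.CriticalPhenomena.Ising3DConformalLimit.Theorems.LogPolarProxyRhoRegularVariation
import HarnessLib

/-!
# `LogPolarProxy.ProxyInversionTransfer` (stmt-CriticalPhenomena-11289) — proved

Route `route-CriticalPhenomena-LogPolarProxy`, sub-problem `Ising3DConformalLimit`, support item #9 (the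
transfer glue, "the mechanism in one lemma"): for every `(ρ, Δ, S)` with `ρ > 0` on `(0,1]`,
`HasPointwiseScalingLimit (criticalCorr 3) ρ S`, `S = 0` off `NonCoincident`, `S n` continuous on
`NonCoincident 3 n`, `S` non-degenerate and scale covariant with exponent `Δ`, the conclusion of the crux
`ProxyUniversality` for `(ρ, S)` — convergence of the renormalised log-polar proxy correlators to `S` off the
axis — implies `IsInversionCovariant Δ S`:
`S n (x₁/‖x₁‖², …, xₙ/‖xₙ‖²) = (∏ᵢ ‖xᵢ‖^{2Δ}) · S n x` for every configuration avoiding the origin.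

## Proof (the route's sketch, made exact)

* §1 The unit inversion `EuclideanGeometry.inversion 0 1 x = x/‖x‖²` preserves `offAxis n`, is continuous
  off the origin and injective.
* §2 If `log ‖pᵢ‖ / π` is IRRATIONAL then `pᵢ` is never on a rounding tie of the radial index
  (`log‖pᵢ‖/δ_N = m + ½` would force `log‖pᵢ‖/π = (2m+1)/(2N+2) ∈ ℚ`), at ANY resolution `N`; and every
  point is eventually inside the radial range `|round(log‖pᵢ‖/δ_N)| ≤ (N+1)²`.
* §3 Core identity on the generic set. For `p ∈ offAxis n` with irrational log-radii, the landed exact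
  symmetry `proxyAvg_inv_sq_smul` (p155813: the grid vertex of `pᵢ/‖pᵢ‖²` is the radial mirror of that of
  `pᵢ`, and the finite Gibbs average is mirror invariant) gives, eventually in `N`,
  `proxyCorr N (Ip) = (∏ᵢ ρ(δ_N/‖pᵢ‖)/ρ(δ_N‖pᵢ‖)) · proxyCorr N p` (the amplitudes `A_N(θᵢ)` cancel since the
  polar angle is inversion invariant); by `RhoRegularVariation` (item 4586, proved) the ratio tends to
  `∏ᵢ ‖pᵢ‖^{2Δ}`, and uniqueness of limits gives `S n (Ip) = (∏ᵢ ‖pᵢ‖^{2Δ}) S n p`.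
* §4 The generic set is dense (Baire: countably many open dense conditions `‖yᵢ‖ ≠ e^{qπ}`, `q ∈ ℚ`, and
  `yᵢ` off the axis), both sides are continuous on the open set `{y injective, all yᵢ ≠ 0}` (continuity of
  `S n` on `NonCoincident`), so the identity extends to it (`Set.EqOn.of_subset_closure`); on non-injective
  configurations both sides vanish by the normalisation of `S`.

Sources: R. C. Brower, G. T. Fleming, H. Neuberger, *Lattice radial quantization: 3D Ising*, Phys. Lett.
B 721 (2013) 299–305, p. 4 ("r = e^t turns dilatations into translations in t and inversion into a parity
in t") [BrowerFlemingNeuberger2013]; P. Di Francesco, P. Mathieu, D. Sénéchal, *Conformal Field Theory*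
(Springer 1997) §4.1 (conformal factor of the inversion) [FrancescoMathieuSenechal1997].
-/

noncomputable section

namespace Summit.CriticalPhenomena.Ising3DConformalLimit.LogPolarProxyProxyInversionTransfer

open scoped BigOperators Topology
open Filter Set Function
open Literature.Probability.LatticeModels
open Summit.CriticalPhenomena.Ising3DConformalLimit.Theses.LogPolarProxy
open Summit.CriticalPhenomena.Ising3DConformalLimit.Cruxes.ProxyUniversality.Birth

/-! ## §1 The unit inversion on `ℝ³ ∖ {0}` -/

/-- The unit inversion of Mathlib is `x ↦ x/‖x‖²`. [folklore] -/
theorem inversion_eq_smul (x : EuclideanSpace ℝ (Fin 3)) :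
    EuclideanGeometry.inversion (0 : EuclideanSpace ℝ (Fin 3)) 1 x = (‖x‖ ^ 2)⁻¹ • x := by
  rw [EuclideanGeometry.inversion, dist_zero_right, vsub_eq_sub, sub_zero, vadd_eq_add, add_zero,
    div_pow, one_pow, one_div]

/-- Coordinates of the inverted point. [folklore] -/
theorem inversion_apply (x : EuclideanSpace ℝ (Fin 3)) (k : Fin 3) :
    EuclideanGeometry.inversion (0 : EuclideanSpace ℝ (Fin 3)) 1 x k = (‖x‖ ^ 2)⁻¹ * x k := by
  rw [inversion_eq_smul, PiLp.smul_apply, smul_eq_mul]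

/-- The unit inversion is continuous off the origin. [folklore] -/
theorem continuousAt_inversion {x : EuclideanSpace ℝ (Fin 3)} (hx : x ≠ 0) :
    ContinuousAt (fun y : EuclideanSpace ℝ (Fin 3) =>
      EuclideanGeometry.inversion (0 : EuclideanSpace ℝ (Fin 3)) 1 y) x := by
  have h : (fun y : EuclideanSpace ℝ (Fin 3) =>
      EuclideanGeometry.inversion (0 : EuclideanSpace ℝ (Fin 3)) 1 y) = fun y => (‖y‖ ^ 2)⁻¹ • y :=
    funext inversion_eq_smul
  rw [h]
  exact ((continuous_norm.pow 2).continuousAt.inv₀ (pow_ne_zero _ (norm_ne_zero_iff.2 hx))).smul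
    continuousAt_id

/-- The unit inversion maps `offAxis n` (injective configurations off the `z`-axis) to itself. [folklore] -/
theorem inversion_mem_offAxis {n : ℕ} {p : Fin n → EuclideanSpace ℝ (Fin 3)} (hp : p ∈ offAxis n) :
    (fun i => EuclideanGeometry.inversion (0 : EuclideanSpace ℝ (Fin 3)) 1 (p i)) ∈ offAxis n := by
  refine ⟨fun i j hij => hp.1 (EuclideanGeometry.inversion_injective _ one_ne_zero hij), fun i h => ?_⟩
  have hc : (‖p i‖ ^ 2)⁻¹ ≠ 0 := inv_ne_zero (pow_ne_zero _ (norm_pos_of_mem_offAxis hp i).ne')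
  rw [inversion_apply, inversion_apply, mul_eq_zero, mul_eq_zero] at h
  exact hp.2 i ⟨h.1.resolve_left hc, h.2.resolve_left hc⟩

/-! ## §2 Irrational log-radii avoid the rounding ties; the radial range is eventually reached -/

/-- If `log r / π` is irrational then `log r / δ_N` is never a half-integer (`δ_N = π/(N+1)`): a tie
`log r / δ_N = m + ½` would give `log r / π = (2m+1)/(2N+2) ∈ ℚ`. [folklore] -/
theorem ne_half_int_of_irrational {r : ℝ} (hr : Irrational (Real.log r / Real.pi)) (N : ℕ) (m : ℤ) :
    Real.log r / (Real.pi / ((N : ℝ) + 1)) ≠ m + 1 / 2 := by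
  intro h
  have hπ : Real.pi ≠ 0 := Real.pi_ne_zero
  have hN : 0 < (N : ℝ) + 1 := Nat.cast_add_one_pos N
  have hq : Real.log r / Real.pi = ((2 * m + 1 : ℤ) : ℝ) / ((2 * ((N : ℤ) + 1) : ℤ) : ℝ) := by
    have h' : Real.log r / Real.pi * ((N : ℝ) + 1) = m + 1 / 2 := by
      rw [← h]; field_simp
    push_cast
    rw [eq_div_iff (by positivity)]
    linarith
  exact (irrational_iff_ne_rational _).1 hr (2 * m + 1) (2 * ((N : ℤ) + 1)) (by omega) hq

/-- Every real `t` is eventually inside the radial range: `|round (t/δ_N)| ≤ (N+1)²`. [folklore] -/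
theorem eventually_abs_round_le (t : ℝ) :
    ∀ᶠ N : ℕ in atTop, |round (t / (Real.pi / ((N : ℝ) + 1)))| ≤ ((N : ℤ) + 1) ^ 2 := by
  have hev : ∀ᶠ N : ℕ in atTop, |t| / Real.pi ≤ (N : ℝ) :=
    (tendsto_natCast_atTop_atTop (R := ℝ)).eventually_ge_atTop _
  filter_upwards [hev] with N hN
  have hN1 : (0 : ℝ) < (N : ℝ) + 1 := Nat.cast_add_one_pos N
  set y : ℝ := t / (Real.pi / ((N : ℝ) + 1)) with hy
  have hyabs : |y| = |t| / Real.pi * ((N : ℝ) + 1) := by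
    rw [hy, div_div_eq_mul_div, abs_div, abs_mul, abs_of_pos hN1, abs_of_pos Real.pi_pos]
    ring
  have hround : |(round y : ℝ)| ≤ |y| + 1 / 2 := by
    have h := abs_sub_round y
    have h2 : |(round y : ℝ)| - |y| ≤ |y - (round y : ℝ)| := by
      rw [abs_sub_comm y]; exact abs_sub_abs_le_abs_sub _ _
    linarith
  have hreal : |(round y : ℝ)| ≤ ((N : ℝ) + 1) ^ 2 := by
    calc |(round y : ℝ)| ≤ |y| + 1 / 2 := hround
      _ = |t| / Real.pi * ((N : ℝ) + 1) + 1 / 2 := by rw [hyabs]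
      _ ≤ (N : ℝ) * ((N : ℝ) + 1) + ((N : ℝ) + 1) := by
          have : |t| / Real.pi * ((N : ℝ) + 1) ≤ (N : ℝ) * ((N : ℝ) + 1) :=
            mul_le_mul_of_nonneg_right hN hN1.le
          linarith
      _ = ((N : ℝ) + 1) ^ 2 := by ring
  exact_mod_cast hreal

/-- The proxy mesh `δ_N = π/(N+1)` is positive. [folklore] -/
theorem proxyMesh_pos (N : ℕ) : 0 < Real.pi / ((N : ℝ) + 1) := div_pos Real.pi_pos (Nat.cast_add_one_pos N)

/-- For every `c`, eventually `δ_N · c ≤ 1`. [folklore] -/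
theorem eventually_proxyMesh_mul_le_one (c : ℝ) :
    ∀ᶠ N : ℕ in atTop, Real.pi / ((N : ℝ) + 1) * c ≤ 1 := by
  have h0 : Tendsto (fun N : ℕ => Real.pi / ((N : ℝ) + 1)) atTop (𝓝 0) :=
    (tendsto_nhdsWithin_iff.1 tendsto_proxyMesh).1
  have h1 : Tendsto (fun N : ℕ => Real.pi / ((N : ℝ) + 1) * c) atTop (𝓝 0) := by
    simpa using h0.mul_const c
  exact (h1.eventually (gt_mem_nhds one_pos)).mono fun N hN => hN.le

/-! ## §3 The core identity on the generic set -/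

/-- **Core transfer.** For an off-axis injective configuration `p` with irrational log-radii
`log ‖pᵢ‖ / π`, convergence of the renormalised proxy correlators to `S n` off the axis and regular
variation of `ρ` with index `−Δ` give `S n (p/‖p‖²) = (∏ᵢ ‖pᵢ‖^{2Δ}) S n p`: eventually in `N` the proxy
correlator at the inverted configuration is `(∏ᵢ ρ(δ_N/‖pᵢ‖)/ρ(δ_N‖pᵢ‖))` times that at `p` (exact radial
mirror symmetry `proxyAvg_inv_sq_smul`, inversion invariance of the polar angle), and the ratio tends to
`∏ᵢ ‖pᵢ‖^{2Δ}`. [cite: BrowerFlemingNeuberger2013, p. 4] -/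
theorem apply_inversion_eq_of_irrational {ρ : ℝ → ℝ} {Δ : ℝ} {S : CorrFamily 3}
    (hρ : ∀ δ ∈ Set.Ioc (0:ℝ) 1, 0 < ρ δ)
    (hRV : TendstoLocallyUniformlyOn (fun (δ c : ℝ) => ρ (c * δ) / ρ δ) (fun c : ℝ => c ^ (-Δ))
      (𝓝[>] (0:ℝ)) (Set.Ioi 0))
    {Jr Jt Jp : ℕ → ℕ → ℝ} {A : ℕ → ℝ → ℝ} {n : ℕ}
    (hconv : TendstoLocallyUniformlyOn (fun N : ℕ => proxyCorr Jr Jt Jp A ρ N n) (S n) atTop (offAxis n))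
    {p : Fin n → EuclideanSpace ℝ (Fin 3)} (hp : p ∈ offAxis n)
    (hirr : ∀ i, Irrational (Real.log ‖p i‖ / Real.pi)) :
    S n (fun i => EuclideanGeometry.inversion (0 : EuclideanSpace ℝ (Fin 3)) 1 (p i)) =
      (∏ i, ‖p i‖ ^ (2 * Δ)) * S n p := by
  set Ip : Fin n → EuclideanSpace ℝ (Fin 3) :=
    fun i => EuclideanGeometry.inversion (0 : EuclideanSpace ℝ (Fin 3)) 1 (p i) with hIp_def
  have hIp : Ip ∈ offAxis n := inversion_mem_offAxis hp
  have hnorm : ∀ i, 0 < ‖p i‖ := norm_pos_of_mem_offAxis hp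
  have hp0 : ∀ i, p i ≠ 0 := fun i => norm_pos_iff.1 (hnorm i)
  -- pointwise limits at `p` and at `Ip`
  have h1 : Tendsto (fun N : ℕ => proxyCorr Jr Jt Jp A ρ N n p) atTop (𝓝 (S n p)) :=
    hconv.tendsto_at hp
  have h2 : Tendsto (fun N : ℕ => proxyCorr Jr Jt Jp A ρ N n Ip) atTop (𝓝 (S n Ip)) :=
    hconv.tendsto_at hIp
  -- eventually: meshes in (0,1] at both radii, radial range reached
  have hsmall : ∀ᶠ N : ℕ in atTop, ∀ i, Real.pi / ((N : ℝ) + 1) * ‖p i‖ ≤ 1 ∧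
      Real.pi / ((N : ℝ) + 1) * ‖p i‖⁻¹ ≤ 1 :=
    eventually_all.2 fun i =>
      (eventually_proxyMesh_mul_le_one ‖p i‖).and (eventually_proxyMesh_mul_le_one ‖p i‖⁻¹)
  have hrange : ∀ᶠ N : ℕ in atTop, ∀ i,
      |round (Real.log ‖p i‖ / (Real.pi / ((N : ℝ) + 1)))| ≤ ((N : ℤ) + 1) ^ 2 :=
    eventually_all.2 fun i => eventually_abs_round_le _
  -- the eventual identity `proxyCorr N Ip = r_N * proxyCorr N p`
  have hident : ∀ᶠ N : ℕ in atTop, proxyCorr Jr Jt Jp A ρ N n Ip =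
      (∏ i, ρ (Real.pi / ((N : ℝ) + 1) * ‖p i‖⁻¹) / ρ (Real.pi / ((N : ℝ) + 1) * ‖p i‖)) *
        proxyCorr Jr Jt Jp A ρ N n p := by
    filter_upwards [hsmall, hrange] with N hN hR
    have hρne : ∀ i, ρ (Real.pi / ((N : ℝ) + 1) * ‖p i‖) ≠ 0 := fun i =>
      (hρ _ ⟨mul_pos (proxyMesh_pos N) (hnorm i), (hN i).1⟩).ne'
    have havg : proxyAvg Jr Jt Jp N n Ip = proxyAvg Jr Jt Jp N n p := by
      have hI : Ip = fun i => (‖p i‖ ^ 2)⁻¹ • p i := funext fun i => inversion_eq_smul (p i)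
      rw [hI]
      exact proxyAvg_inv_sq_smul Jr Jt Jp N n p hp0
        (fun i m => ne_half_int_of_irrational (hirr i) N m) hR
    have hw : weight A ρ N n Ip =
        ∏ i, A N (Real.arccos (p i 2 / ‖p i‖)) * ρ (Real.pi / ((N : ℝ) + 1) * ‖p i‖⁻¹) := by
      unfold weight
      refine Finset.prod_congr rfl fun i _ => ?_
      rw [hIp_def]
      dsimp only
      rw [inversion_eq_smul, inv_sq_smul_polar (hp0 i), norm_inv_sq_smul (hp0 i)]
    rw [proxyCorr, proxyCorr, havg, hw, weight, ← mul_assoc, ← Finset.prod_mul_distrib]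
    congr 1
    refine Finset.prod_congr rfl fun i _ => ?_
    have key : ∀ X R R' : ℝ, R ≠ 0 → X * R' = R' / R * (X * R) := by
      intro X R R' hR
      rw [div_mul_eq_mul_div, eq_div_iff hR]
      ring
    exact key _ _ _ (hρne i)
  -- the ratio tends to `∏ ‖p i‖ ^ (2Δ)`
  have hmesh1 : ∀ᶠ N : ℕ in atTop, Real.pi / ((N : ℝ) + 1) ≤ 1 := by
    simpa using eventually_proxyMesh_mul_le_one (1:ℝ)
  have hr : Tendsto
      (fun N : ℕ => ∏ i, ρ (Real.pi / ((N : ℝ) + 1) * ‖p i‖⁻¹) / ρ (Real.pi / ((N : ℝ) + 1) * ‖p i‖))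
      atTop (𝓝 (∏ i, ‖p i‖ ^ (2 * Δ))) := by
    refine tendsto_finsetProd _ fun i _ => ?_
    have hc : 0 < ‖p i‖ := hnorm i
    have hA : Tendsto (fun N : ℕ => ρ (‖p i‖⁻¹ * (Real.pi / ((N : ℝ) + 1))) /
        ρ (Real.pi / ((N : ℝ) + 1))) atTop (𝓝 ((‖p i‖⁻¹) ^ (-Δ))) :=
      (hRV.tendsto_at (Set.mem_Ioi.2 (inv_pos.2 hc))).comp tendsto_proxyMesh
    have hB : Tendsto (fun N : ℕ => ρ (‖p i‖ * (Real.pi / ((N : ℝ) + 1))) /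
        ρ (Real.pi / ((N : ℝ) + 1))) atTop (𝓝 (‖p i‖ ^ (-Δ))) :=
      (hRV.tendsto_at (Set.mem_Ioi.2 hc)).comp tendsto_proxyMesh
    have hBne : ‖p i‖ ^ (-Δ) ≠ 0 := (Real.rpow_pos_of_pos hc _).ne'
    have hlim : (‖p i‖⁻¹) ^ (-Δ) / ‖p i‖ ^ (-Δ) = ‖p i‖ ^ (2 * Δ) := by
      rw [Real.inv_rpow hc.le, Real.rpow_neg hc.le, inv_inv, div_inv_eq_mul, ← Real.rpow_add hc,
        two_mul]
    rw [← hlim]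
    refine (hA.div hB hBne).congr' ?_
    filter_upwards [hmesh1] with N hN
    have hρδ : ρ (Real.pi / ((N : ℝ) + 1)) ≠ 0 := (hρ _ ⟨proxyMesh_pos N, hN⟩).ne'
    simp only [Pi.div_apply]
    rw [div_div_div_cancel_right₀ hρδ, mul_comm (‖p i‖⁻¹), mul_comm (‖p i‖)]
  -- uniqueness of limits
  have h3 : Tendsto (fun N : ℕ => proxyCorr Jr Jt Jp A ρ N n Ip) atTop
      (𝓝 ((∏ i, ‖p i‖ ^ (2 * Δ)) * S n p)) :=
    (hr.mul h1).congr' (hident.mono fun N h => h.symm)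
  exact tendsto_nhds_unique h2 h3

/-! ## §4 The generic set is dense -/

/-- Configurations with the `i`-th point off the `z`-axis form an open set. [folklore] -/
theorem isOpen_offAxisAt (n : ℕ) (i : Fin n) :
    IsOpen {y : Fin n → EuclideanSpace ℝ (Fin 3) | ¬ (y i 0 = 0 ∧ y i 1 = 0)} := by
  have hc0 : Continuous fun p : Fin n → EuclideanSpace ℝ (Fin 3) => p i 0 :=
    (EuclideanSpace.proj (0 : Fin 3)).continuous.comp (continuous_apply i)
  have hc1 : Continuous fun p : Fin n → EuclideanSpace ℝ (Fin 3) => p i 1 :=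
    (EuclideanSpace.proj (1 : Fin 3)).continuous.comp (continuous_apply i)
  have : {p : Fin n → EuclideanSpace ℝ (Fin 3) | ¬ (p i 0 = 0 ∧ p i 1 = 0)} =
      ({p | p i 0 = 0} ∩ {p | p i 1 = 0})ᶜ := by
    ext p; simp [Set.mem_compl_iff, not_and]
  rw [this]
  exact ((isClosed_eq hc0 continuous_const).inter (isClosed_eq hc1 continuous_const)).isOpen_compl

/-- Configurations with the `i`-th point off the `z`-axis are dense: push `yᵢ` off the axis along `e₀`.
[folklore] -/
theorem dense_offAxisAt (n : ℕ) (i : Fin n) :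
    Dense {y : Fin n → EuclideanSpace ℝ (Fin 3) | ¬ (y i 0 = 0 ∧ y i 1 = 0)} := by
  intro y
  by_cases hy : ¬ (y i 0 = 0 ∧ y i 1 = 0)
  · exact subset_closure hy
  rw [not_not] at hy
  -- the curve t ↦ update y i (y i + t • e₀), t → 0, t ≠ 0
  let f : ℝ → (Fin n → EuclideanSpace ℝ (Fin 3)) :=
    fun t => Function.update y i (y i + t • EuclideanSpace.single (0 : Fin 3) (1:ℝ))
  have hf : Continuous f :=
    continuous_const.update i (continuous_const.add (continuous_id.smul continuous_const))
  have hf0 : f 0 = y := by simp [f]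
  have hlim : Tendsto f (𝓝[≠] (0:ℝ)) (𝓝 y) := by
    rw [← hf0]; exact (hf.tendsto 0).mono_left nhdsWithin_le_nhds
  refine mem_closure_of_tendsto hlim (eventually_nhdsWithin_of_forall fun t ht => ?_)
  have ht' : t ≠ 0 := ht
  simp only [Set.mem_setOf_eq, f, Function.update_self]
  intro h
  apply ht'
  have h0 := h.1
  simp [hy.1] at h0
  exact h0

/-- Configurations with `‖yᵢ‖ ≠ r` form an open set. [folklore] -/
theorem isOpen_norm_ne (n : ℕ) (i : Fin n) (r : ℝ) :
    IsOpen {y : Fin n → EuclideanSpace ℝ (Fin 3) | ‖y i‖ ≠ r} :=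
  isOpen_ne_fun (continuous_apply i).norm continuous_const

/-- Configurations with `‖yᵢ‖ ≠ r` are dense for `r ≠ 0`: rescale `yᵢ` radially. [folklore] -/
theorem dense_norm_ne (n : ℕ) (i : Fin n) {r : ℝ} (hr : r ≠ 0) :
    Dense {y : Fin n → EuclideanSpace ℝ (Fin 3) | ‖y i‖ ≠ r} := by
  intro y
  by_cases hy : ‖y i‖ ≠ r
  · exact subset_closure hy
  rw [not_ne_iff] at hy
  let f : ℝ → (Fin n → EuclideanSpace ℝ (Fin 3)) := fun t => Function.update y i ((1 + t) • y i)
  have hf : Continuous f :=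
    continuous_const.update i ((continuous_const.add continuous_id).smul continuous_const)
  have hf0 : f 0 = y := by simp [f]
  have hlim : Tendsto f (𝓝[>] (0:ℝ)) (𝓝 y) := by
    rw [← hf0]; exact (hf.tendsto 0).mono_left nhdsWithin_le_nhds
  refine mem_closure_of_tendsto hlim (eventually_nhdsWithin_of_forall fun t (ht : 0 < t) => ?_)
  simp only [Set.mem_setOf_eq, f, Function.update_self, norm_smul, hy, Real.norm_eq_abs,
    abs_of_pos (by linarith : (0:ℝ) < 1 + t)]
  intro h
  have : (1 + t) * r = 1 * r := by rw [h, one_mul]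
  have := mul_right_cancel₀ hr this
  linarith

/-- **The generic set is dense**: configurations with every point off the `z`-axis and every radius
outside the countable set `{e^{qπ} : q ∈ ℚ}` are dense (Baire category theorem). [folklore] -/
theorem dense_generic (n : ℕ) :
    Dense {y : Fin n → EuclideanSpace ℝ (Fin 3) |
      (∀ i, ¬ (y i 0 = 0 ∧ y i 1 = 0)) ∧ ∀ i (q : ℚ), ‖y i‖ ≠ Real.exp (q * Real.pi)} := by
  have hD : Dense (⋂ iq : Fin n × ℚ,
      ({y : Fin n → EuclideanSpace ℝ (Fin 3) | ¬ (y iq.1 0 = 0 ∧ y iq.1 1 = 0)} ∩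
        {y | ‖y iq.1‖ ≠ Real.exp (iq.2 * Real.pi)})) :=
    dense_iInter_of_isOpen (fun iq => (isOpen_offAxisAt n iq.1).inter (isOpen_norm_ne n iq.1 _))
      fun iq => (dense_offAxisAt n iq.1).inter_of_isOpen_left (dense_norm_ne n iq.1 (Real.exp_pos _).ne')
        (isOpen_offAxisAt n iq.1)
  refine hD.mono fun y hy => ?_
  simp only [Set.mem_iInter, Set.mem_inter_iff, Set.mem_setOf_eq, Prod.forall] at hy
  exact ⟨fun i => (hy i 0).1, fun i q => (hy i q).2⟩

/-! ## §5 The item -/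

/-- **Item stmt-CriticalPhenomena-11289 `ProxyInversionTransfer`, proved**: for every `(ρ, Δ, S)` with
`ρ > 0` on `(0,1]`, `HasPointwiseScalingLimit (criticalCorr 3) ρ S`, `S = 0` off `NonCoincident`, `S n`
continuous on `NonCoincident 3 n`, `S` non-degenerate and scale covariant with `Δ`, the conclusion of
`ProxyUniversality` for `(ρ, S)` implies `IsInversionCovariant Δ S`. On the dense generic part of
`offAxis n` this is `apply_inversion_eq_of_irrational` (exact radial-mirror symmetry of the proxy +
`RhoRegularVariation`); it extends to all injective configurations avoiding the origin by continuity of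
both sides (`Set.EqOn.of_subset_closure`), and holds trivially on non-injective ones (both sides vanish).
[cite: BrowerFlemingNeuberger2013, p. 4] -/
theorem proxyInversionTransfer_proof : ProxyInversionTransfer := by
  intro ρ Δ S hρ hlim hzero hcont hnd hsc hprox
  obtain ⟨Jr, Jt, Jp, A, -, -, hconv⟩ := hprox
  have hRV := LogPolarProxyRhoRegularVariation.rhoRegularVariation_proof ρ Δ S hρ hlim hnd hsc
  intro n x hx0
  by_cases hinj : Injective x
  · -- the open set of injective configurations avoiding the origin
    set U : Set (Fin n → EuclideanSpace ℝ (Fin 3)) := {y | Injective y ∧ ∀ i, y i ≠ 0} with hU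
    have hUopen : IsOpen U := by
      have h2 : IsOpen {y : Fin n → EuclideanSpace ℝ (Fin 3) | ∀ i, y i ≠ 0} := by
        rw [Set.setOf_forall]
        exact isOpen_iInter_of_finite fun i =>
          isOpen_ne_fun (continuous_apply (A := fun _ : Fin n => EuclideanSpace ℝ (Fin 3)) i)
            continuous_const
      exact (isOpen_nonCoincident 3 n).inter h2
    have hxU : x ∈ U := ⟨hinj, hx0⟩
    -- both sides are continuous on U
    have hΦ : ContinuousOn (fun y : Fin n → EuclideanSpace ℝ (Fin 3) => fun i =>
        EuclideanGeometry.inversion (0 : EuclideanSpace ℝ (Fin 3)) 1 (y i)) U :=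
      continuousOn_pi.2 fun i y hy => by
        have hproj : ContinuousAt (fun z : Fin n → EuclideanSpace ℝ (Fin 3) => z i) y :=
          (continuous_apply i).continuousAt
        exact ((continuousAt_inversion (hy.2 i)).comp_of_eq hproj rfl).continuousWithinAt
    have hmaps : MapsTo (fun y : Fin n → EuclideanSpace ℝ (Fin 3) => fun i =>
        EuclideanGeometry.inversion (0 : EuclideanSpace ℝ (Fin 3)) 1 (y i)) U (NonCoincident 3 n) :=
      fun y hy i j hij => hy.1 (EuclideanGeometry.inversion_injective _ one_ne_zero hij)
    have hf : ContinuousOn (fun y : Fin n → EuclideanSpace ℝ (Fin 3) =>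
        S n (fun i => EuclideanGeometry.inversion (0 : EuclideanSpace ℝ (Fin 3)) 1 (y i))) U :=
      (hcont n).comp hΦ hmaps
    have hg : ContinuousOn (fun y : Fin n → EuclideanSpace ℝ (Fin 3) =>
        (∏ i, ‖y i‖ ^ (2 * Δ)) * S n y) U := by
      refine ContinuousOn.mul ?_ ((hcont n).mono fun y hy => hy.1)
      exact continuousOn_finsetProd _ fun i _ =>
        ((continuous_apply i).norm.continuousOn.rpow_const fun y hy =>
          Or.inl (norm_ne_zero_iff.2 (hy.2 i)))
    -- the identity on the dense generic part of `offAxis n`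
    set E : Set (Fin n → EuclideanSpace ℝ (Fin 3)) :=
      offAxis n ∩ {y | ∀ i, Irrational (Real.log ‖y i‖ / Real.pi)} with hE
    have hEq : EqOn (fun y : Fin n → EuclideanSpace ℝ (Fin 3) =>
          S n (fun i => EuclideanGeometry.inversion (0 : EuclideanSpace ℝ (Fin 3)) 1 (y i)))
        (fun y => (∏ i, ‖y i‖ ^ (2 * Δ)) * S n y) E :=
      fun y hy => apply_inversion_eq_of_irrational hρ hRV (hconv n) hy.1 hy.2
    have hEU : E ⊆ U := fun y hy =>
      ⟨hy.1.1, fun i => norm_pos_iff.1 (norm_pos_of_mem_offAxis hy.1 i)⟩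
    have hUcl : U ⊆ closure E := by
      refine ((dense_generic n).open_subset_closure_inter hUopen).trans (closure_mono ?_)
      rintro y ⟨hyU, hyA, hyO⟩
      refine ⟨⟨hyU.1, hyA⟩, fun i => ?_⟩
      rintro ⟨q, hq⟩
      refine hyO i q ?_
      have hpos : 0 < ‖y i‖ := norm_pos_iff.2 (hyU.2 i)
      have hlog : Real.log ‖y i‖ = q * Real.pi := ((eq_div_iff Real.pi_ne_zero).1 hq).symm
      rw [← hlog, Real.exp_log hpos]
    exact hEq.of_subset_closure hf hg hEU hUcl hxU
  · -- non-injective configurations: both sides vanish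
    have h1 : S n x = 0 := hzero n x hinj
    have h2 : S n (fun i => EuclideanGeometry.inversion (0 : EuclideanSpace ℝ (Fin 3)) 1 (x i)) = 0 :=
      hzero n _ fun h => hinj fun i j hij => h (by simp only [hij])
    rw [h1, h2, mul_zero]

end Summit.CriticalPhenomena.Ising3DConformalLimit.LogPolarProxyProxyInversionTransfer

end
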